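import Summits.QuantumFields.YangMills.Theorems.ToronSmallBallSheetTranslate
import Literature.MathematicalPhysics.QuantumFieldTheory.LatticeGaugeDobrushinPoincare
import HarnessLib

/-!
# The sheet translate `twist k h` with a non-central `h`: the change of the Wilson action is a sum of plane defects, each bounded by a commutator

Support module for the covariant-translate cruxes of seat ym-idea-4's LINE g12-A/B (`ToronSmallBall.OffCoreStripWindowDeep` ⟨stmt-QuantumFields-23957⟩,
`ToronCoreRaritySubQuartic` ⟨23956⟩, `QuantileBitPurity.HolonomyLevyWindowDeep` ⟨23949⟩, `HolonomyQuantileSubQuartic` ⟨23948⟩; memo HOME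
`bc/g12-A/PLAN-X1-v2-gauss.md` §2).  Companion of `ToronSmallBallSheetTranslate`:

* ★ `wilsonAction_twist_sub` (any group, any representation): `S(twist_k^h U) − S(U) = Σ_{p on the plane x_k = 0, p ∋ k} (Re tr ρ(U_p) − Re tr ρ((twist_k^h U)_p))`
  — an EXACT decomposition: plaquettes off the plane or in planes not containing `k` do not contribute;
* ★ `abs_re_trace_plaquette_twist_fst_sub_le`, `abs_re_trace_plaquette_twist_snd_sub_le` (unitary `ρ`): each plane defect is bounded by the Frobenius
  norm of ONE commutator, `|Re tr ρ(U_p) − Re tr ρ((twist_k^h U)_p)| ≤ √N · ‖ρ(h)ρ(Y) − ρ(Y)ρ(h)‖_F`, `Y` the transverse link of `p` at the plane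
  (`U(x,j)` resp. `U(x,i)`) — the «defect = commutator of `h` with the transverse link» of PLAN-X1 v2 §2, with nothing else hidden
  (Cauchy–Schwarz `|Re tr(X − Y)| ≤ √N‖X − Y‖_F`, unitary invariance of `‖·‖_F`).

HONEST FRAMING: exact fixed-lattice identities and a one-line trace inequality; no estimate on any measure, no semiclassics; nothing about infinite
volume, the continuum limit or the Clay gap.  No `sorry`, no new axiom, no new definition.
References: [cite: tHooft1979]; [cite: Luscher1983, §2]; [cite: Wilson1974].
-/

set_option autoImplicit false

noncomputable section

open MeasureTheory Filter Topology
open Literature.MathematicalPhysics.QuantumFieldTheory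
open Literature.MathematicalPhysics.QuantumLattice
open scoped BigOperators

namespace Summit.QuantumFields.YangMills.Theorems.FemtoTransferGap

section General

variable {N : ℕ} {G : Type*} [Group G] (ρ : G →* Matrix (Fin N) (Fin N) ℂ) {L : ℕ} [NeZero L]

/-- ★ **The action change under a sheet translate is a sum of plane defects**: for any `h ∈ G`,
`S(twist_k^h U) − S(U) = Σ_{p : x_k = 0 ∧ (i = k ∨ j = k)} (Re tr ρ(U_p) − Re tr ρ((twist_k^h U)_p))`; every other plaquette holonomy is unchanged
(`plaquetteHolonomy_twist_of_apply_ne_zero`, `plaquetteHolonomy_twist_of_ne_of_ne`). [cite: tHooft1979] [cite: Wilson1974] -/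
theorem wilsonAction_twist_sub (k : Fin 3) (h : G) (U : GaugeConfig 3 L G) :
    wilsonAction ρ (twist k h U) - wilsonAction ρ U =
      ∑ p ∈ Finset.univ.filter (fun p : Plaquette 3 L => p.1 k = 0 ∧ (p.2.1.1 = k ∨ p.2.1.2 = k)),
        ((ρ (plaquetteHolonomy U p.1 p.2.1.1 p.2.1.2)).trace.re - (ρ (plaquetteHolonomy (twist k h U) p.1 p.2.1.1 p.2.1.2)).trace.re) := by
  unfold wilsonAction
  rw [← Finset.sum_sub_distrib]
  have hterm : ∀ p : Plaquette 3 L,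
      ((N : ℝ) - (ρ (plaquetteHolonomy (twist k h U) p.1 p.2.1.1 p.2.1.2)).trace.re) -
        ((N : ℝ) - (ρ (plaquetteHolonomy U p.1 p.2.1.1 p.2.1.2)).trace.re) =
      (ρ (plaquetteHolonomy U p.1 p.2.1.1 p.2.1.2)).trace.re - (ρ (plaquetteHolonomy (twist k h U) p.1 p.2.1.1 p.2.1.2)).trace.re :=
    fun p => by ring
  simp only [hterm]
  symm
  refine Finset.sum_filter_of_ne fun p _ hp => ?_
  -- a non-zero term forces the plaquette onto the plane and into a plane containing `k`
  by_contra hnot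
  apply hp
  have hij : p.2.1.1 ≠ p.2.1.2 := ne_of_lt p.2.2
  have hsame : plaquetteHolonomy (twist k h U) p.1 p.2.1.1 p.2.1.2 = plaquetteHolonomy U p.1 p.2.1.1 p.2.1.2 := by
    by_cases hx : p.1 k = 0
    · have hne : ¬ (p.2.1.1 = k ∨ p.2.1.2 = k) := fun h' => hnot ⟨hx, h'⟩
      exact plaquetteHolonomy_twist_of_ne_of_ne k h U p.1 (fun h1 => hne (Or.inl h1)) (fun h2 => hne (Or.inr h2))
    · exact plaquetteHolonomy_twist_of_apply_ne_zero k h U p.1 hij hx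
  rw [hsame, sub_self]

end General

/-! ## The plane defects are bounded by commutators (unitary representation) -/

section Unitary

variable {N : ℕ} {G : Type*} [Group G] (ρ : G →* Matrix (Fin N) (Fin N) ℂ) (hρu : ∀ g, ρ g ∈ Matrix.unitaryGroup (Fin N) ℂ) {L : ℕ}

include hρu in
/-- `‖ρ(h⁻¹ Y h) − ρ(Y)‖_F = ‖ρ(h)ρ(Y) − ρ(Y)ρ(h)‖_F` for a unitary representation. [folklore] -/
theorem frobNorm_map_conj_sub_eq (h Y : G) :
    frobNorm (ρ (h⁻¹ * Y * h) - ρ Y) = frobNorm (ρ h * ρ Y - ρ Y * ρ h) := by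
  have e1 : ρ h * (ρ (h⁻¹ * Y * h) - ρ Y) = ρ Y * ρ h - ρ h * ρ Y := by
    rw [Matrix.mul_sub, map_mul, map_mul, ← Matrix.mul_assoc, ← Matrix.mul_assoc, ← map_mul, mul_inv_cancel, map_one, Matrix.one_mul]
  rw [← frobNorm_unitary_mul (hρu h), e1, ← frobNorm_sub_comm]

include hρu in
/-- ★ **First plane defect ≤ one commutator**: for `k ≠ j`, `x_k = 0` and a unitary representation,
`|Re tr ρ(U_{x;k,j}) − Re tr ρ((twist_k^h U)_{x;k,j})| ≤ √N · ‖ρ(h) ρ(U(x,j)) − ρ(U(x,j)) ρ(h)‖_F` (the holonomy changes by conjugating the transverse link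
`U(x,j)⁻¹` by `h`, `trace_plaquetteHolonomy_twist_fst`). [cite: tHooft1979] [cite: Luscher1983, §2] -/
theorem abs_re_trace_plaquette_twist_fst_sub_le [NeZero L] (k : Fin 3) (h : G) (U : GaugeConfig 3 L G) (x : Site 3 L) {j : Fin 3} (hkj : k ≠ j)
    (hx : x k = 0) :
    |(ρ (plaquetteHolonomy U x k j)).trace.re - (ρ (plaquetteHolonomy (twist k h U) x k j)).trace.re| ≤
      Real.sqrt N * frobNorm (ρ h * ρ (U (x, j)) - ρ (U (x, j)) * ρ h) := by
  -- `|Re tr X − Re tr Y| ≤ √N ‖X − Y‖_F` (Cauchy–Schwarz against `1`; the tree's `abs_re_trace_sub_le`)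
  have hcs : ∀ X Y : Matrix (Fin N) (Fin N) ℂ, |X.trace.re - Y.trace.re| ≤ Real.sqrt N * frobNorm (X - Y) := fun X Y => by
    have h1 : frobNorm (1 : Matrix (Fin N) (Fin N) ℂ) = Real.sqrt N := by
      rw [← Real.sqrt_sq (frobNorm_nonneg _), frobNorm_sq_of_mem_unitaryGroup (Submonoid.one_mem _), Fintype.card_fin]
    have := abs_re_trace_mul_le (1 : Matrix (Fin N) (Fin N) ℂ) (X - Y)
    rwa [one_mul, h1, Matrix.trace_sub, Complex.sub_re] at this
  rw [trace_plaquetteHolonomy_twist_fst ρ k h U x hkj hx]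
  set X : G := U (x, k) * U (x.shift k, j) * (U (x.shift j, k))⁻¹ with hX
  have hhol : plaquetteHolonomy U x k j = X * (U (x, j))⁻¹ := rfl
  rw [hhol, map_mul, map_mul ρ X]
  refine (hcs _ _).trans ?_
  refine mul_le_mul_of_nonneg_left ?_ (Real.sqrt_nonneg _)
  rw [← Matrix.mul_sub, frobNorm_unitary_mul (hρu X), frobNorm_sub_comm, frobNorm_map_conj_sub_eq ρ hρu h (U (x, j))⁻¹]
  -- `‖[ρ h, ρ Y⁻¹]‖ = ‖[ρ h, ρ Y]‖`: conjugate by the unitary `ρ Y`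
  have e2 : ρ (U (x, j)) * (ρ h * ρ (U (x, j))⁻¹ - ρ (U (x, j))⁻¹ * ρ h) * ρ (U (x, j)) = ρ (U (x, j)) * ρ h - ρ h * ρ (U (x, j)) := by
    have hA : ρ (U (x, j))⁻¹ * ρ (U (x, j)) = 1 := by rw [← map_mul, inv_mul_cancel, map_one]
    have hB : ρ (U (x, j)) * ρ (U (x, j))⁻¹ = 1 := by rw [← map_mul, mul_inv_cancel, map_one]
    calc ρ (U (x, j)) * (ρ h * ρ (U (x, j))⁻¹ - ρ (U (x, j))⁻¹ * ρ h) * ρ (U (x, j))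
        = ρ (U (x, j)) * ρ h * (ρ (U (x, j))⁻¹ * ρ (U (x, j))) - (ρ (U (x, j)) * ρ (U (x, j))⁻¹) * ρ h * ρ (U (x, j)) := by
          noncomm_ring
      _ = ρ (U (x, j)) * ρ h - ρ h * ρ (U (x, j)) := by rw [hA, hB, Matrix.mul_one, Matrix.one_mul]
  rw [← frobNorm_unitary_mul (hρu (U (x, j))), ← frobNorm_mul_unitary _ (hρu (U (x, j))), e2, frobNorm_sub_comm]

include hρu in
/-- ★ **Second plane defect ≤ one commutator**: for `i ≠ k`, `x_k = 0` and a unitary representation,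
`|Re tr ρ(U_{x;i,k}) − Re tr ρ((twist_k^h U)_{x;i,k})| ≤ √N · ‖ρ(h) ρ(U(x,i)) − ρ(U(x,i)) ρ(h)‖_F` (the holonomy changes by conjugating the first link
`U(x,i)` by `h`, `trace_plaquetteHolonomy_twist_snd`). [cite: tHooft1979] [cite: Luscher1983, §2] -/
theorem abs_re_trace_plaquette_twist_snd_sub_le [NeZero L] (k : Fin 3) (h : G) (U : GaugeConfig 3 L G) (x : Site 3 L) {i : Fin 3} (hik : i ≠ k)
    (hx : x k = 0) :
    |(ρ (plaquetteHolonomy U x i k)).trace.re - (ρ (plaquetteHolonomy (twist k h U) x i k)).trace.re| ≤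
      Real.sqrt N * frobNorm (ρ h * ρ (U (x, i)) - ρ (U (x, i)) * ρ h) := by
  -- `|Re tr X − Re tr Y| ≤ √N ‖X − Y‖_F` (Cauchy–Schwarz against `1`; the tree's `abs_re_trace_sub_le`)
  have hcs : ∀ X Y : Matrix (Fin N) (Fin N) ℂ, |X.trace.re - Y.trace.re| ≤ Real.sqrt N * frobNorm (X - Y) := fun X Y => by
    have h1 : frobNorm (1 : Matrix (Fin N) (Fin N) ℂ) = Real.sqrt N := by
      rw [← Real.sqrt_sq (frobNorm_nonneg _), frobNorm_sq_of_mem_unitaryGroup (Submonoid.one_mem _), Fintype.card_fin]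
    have := abs_re_trace_mul_le (1 : Matrix (Fin N) (Fin N) ℂ) (X - Y)
    rwa [one_mul, h1, Matrix.trace_sub, Complex.sub_re] at this
  rw [trace_plaquetteHolonomy_twist_snd ρ k h U x hik hx]
  set X : G := U (x.shift i, k) * (U (x.shift k, i))⁻¹ * (U (x, k))⁻¹ with hX
  have hhol : plaquetteHolonomy U x i k = U (x, i) * X := by
    simp only [plaquetteHolonomy, hX, mul_assoc]
  rw [hhol, map_mul, map_mul ρ _ X]
  -- move `ρ X` to the front by cyclicity, then peel it off as a unitary factor
  have hc1 : (ρ (U (x, i)) * ρ X).trace = (ρ X * ρ (U (x, i))).trace := Matrix.trace_mul_comm _ _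
  have hc2 : (ρ (h⁻¹ * U (x, i) * h) * ρ X).trace = (ρ X * ρ (h⁻¹ * U (x, i) * h)).trace := Matrix.trace_mul_comm _ _
  rw [hc1, hc2]
  refine (hcs _ _).trans ?_
  refine mul_le_mul_of_nonneg_left ?_ (Real.sqrt_nonneg _)
  rw [← Matrix.mul_sub, frobNorm_unitary_mul (hρu X), frobNorm_sub_comm, frobNorm_map_conj_sub_eq ρ hρu h (U (x, i))]

end Unitary

end Summit.QuantumFields.YangMills.Theorems.FemtoTransferGap

end
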